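import Mathlib
import Summits.Ventures.PercRepro2.TypedHat
import Summits.Ventures.PercRepro2.TypedMask

/-!
# The degree-three star on an arbitrary base, in masked form (blind cell PercRepro2, p2 g3,
2026-08-25) — mine-1 §23.1's identities over any base

An unmarked vertex `u` with typed edges `e₁, e₂, e₃` to `v₁, v₂, v₃` (ANY vertices — marks or not;
the base `B = F ∖ {e₁, e₂, e₃}` arbitrary, with its own unmarked vertices): the typed base is the
STAR SUM `starSumM` of the masked counts of `B` at the 27 placements, each copy carrying the
clique mask of its open neighbours (`typedCount_star3_sum`), and the star sums at the eight mixed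
type vectors are the copy-symmetrised PIECES `pN`, `pE`, `pE2`, `pM`, `pC`, `pB` of mine-1 §23.1
with the same nonnegative integer coefficients as on `K₅` (`starSumM_111_pieces` …): the objects
over which the hyperstar Props quantify, on any base.
-/

namespace Summit.Ventures.PercRepro2

namespace CovForm

namespace TypedRed

namespace Mask

open TwoTerm OneTyped

section Masks

variable {V : Type*} [DecidableEq V]

/-- The clique mask of a vertex set: the ordered pairs of distinct vertices of `S`. -/
def cliq (S : Finset V) : Finset (V × V) := (S ×ˢ S).filter fun xy => xy.1 ≠ xy.2

/-- Membership in the clique mask. -/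
lemma mem_cliq {S : Finset V} {xy : V × V} : xy ∈ cliq S ↔ xy.1 ∈ S ∧ xy.2 ∈ S ∧ xy.1 ≠ xy.2 := by
  simp [cliq, and_assoc]

/-- The clique mask of a singleton is empty. -/
lemma cliq_singleton (v : V) : cliq {v} = ∅ := by
  ext xy
  simp [mem_cliq]
  intro h1 h2
  rw [h1, h2]

/-- The open neighbours of a star placement state. -/
def nbrs (v₁ v₂ v₃ : V) (s₁ s₂ s₃ : Bool) : Finset V :=
  (if s₁ then {v₁} else ∅) ∪ (if s₂ then {v₂} else ∅) ∪ (if s₃ then {v₃} else ∅)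

/-- The star mask of a copy. -/
def sMask (v₁ v₂ v₃ : V) (s₁ s₂ s₃ : Bool) : Finset (V × V) := cliq (nbrs v₁ v₂ v₃ s₁ s₂ s₃)

/-- Membership in the open neighbours. -/
lemma mem_nbrs {v₁ v₂ v₃ : V} {s₁ s₂ s₃ : Bool} {x : V} :
    x ∈ nbrs v₁ v₂ v₃ s₁ s₂ s₃ ↔ (s₁ = true ∧ x = v₁) ∨ (s₂ = true ∧ x = v₂) ∨
      (s₃ = true ∧ x = v₃) := by
  simp only [nbrs, Finset.mem_union]
  cases s₁ <;> cases s₂ <;> cases s₃ <;> simp [or_assoc]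

/-- The star mask with no open edge is empty. -/
lemma sMask_fff (v₁ v₂ v₃ : V) : sMask v₁ v₂ v₃ false false false = ∅ := by
  simp [sMask, nbrs, cliq]

/-- One open edge: no mask. -/
lemma sMask_tff (v₁ v₂ v₃ : V) : sMask v₁ v₂ v₃ true false false = ∅ := by
  simp [sMask, nbrs, cliq_singleton]

/-- One open edge: no mask. -/
lemma sMask_ftf (v₁ v₂ v₃ : V) : sMask v₁ v₂ v₃ false true false = ∅ := by
  simp [sMask, nbrs, cliq_singleton]

/-- One open edge: no mask. -/
lemma sMask_fft (v₁ v₂ v₃ : V) : sMask v₁ v₂ v₃ false false true = ∅ := by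
  simp [sMask, nbrs, cliq_singleton]

/-- Two open edges: the pair mask. -/
lemma sMask_ttf (v₁ v₂ v₃ : V) : sMask v₁ v₂ v₃ true true false = cliq {v₁, v₂} := by
  simp [sMask, nbrs]

/-- Two open edges: the pair mask. -/
lemma sMask_tft (v₁ v₂ v₃ : V) : sMask v₁ v₂ v₃ true false true = cliq {v₁, v₃} := by
  simp [sMask, nbrs]

/-- Two open edges: the pair mask. -/
lemma sMask_ftt (v₁ v₂ v₃ : V) : sMask v₁ v₂ v₃ false true true = cliq {v₂, v₃} := by
  simp [sMask, nbrs]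

/-- Three open edges: the triangle mask. -/
lemma sMask_ttt (v₁ v₂ v₃ : V) : sMask v₁ v₂ v₃ true true true = cliq {v₁, v₂, v₃} := by
  simp [sMask, nbrs]

end Masks

/-! ## The terminal relation of a star placement is the clique of its open neighbours -/

section StarRel

variable {V : Type*} [DecidableEq V] {E : Type*} [DecidableEq E]

/-- In a configuration supported on the three star edges, two vertices other than `u` are joined
iff both are open neighbours (or equal). -/
lemma conn_star_iff {ends : E → Sym2 V} {u v₁ v₂ v₃ : V} {e₁ e₂ e₃ : E}
    (he₁ : ends e₁ = s(u, v₁)) (he₂ : ends e₂ = s(u, v₂)) (he₃ : ends e₃ = s(u, v₃))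
    (hv₁ : v₁ ≠ u) (hv₂ : v₂ ≠ u) (hv₃ : v₃ ≠ u) {a : Config E}
    (ha : ∀ e, e ≠ e₁ → e ≠ e₂ → e ≠ e₃ → a e = false) {x y : V} (hx : x ≠ u) (hy : y ≠ u)
    (hxy : x ≠ y) :
    Conn ends a x y ↔ x ∈ nbrs v₁ v₂ v₃ (a e₁) (a e₂) (a e₃) ∧ y ∈ nbrs v₁ v₂ v₃ (a e₁) (a e₂) (a e₃) := by
  -- an open edge is a star edge whose neighbour is open
  have hopen : ∀ e, a e = true → ∀ w ∈ ends e, w = u ∨ w ∈ nbrs v₁ v₂ v₃ (a e₁) (a e₂) (a e₃) := by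
    intro e he w hw
    by_cases h1 : e = e₁
    · subst h1; rw [he₁, Sym2.mem_iff] at hw
      rcases hw with rfl | rfl
      · exact Or.inl rfl
      · exact Or.inr (mem_nbrs.2 (Or.inl ⟨he, rfl⟩))
    by_cases h2 : e = e₂
    · subst h2; rw [he₂, Sym2.mem_iff] at hw
      rcases hw with rfl | rfl
      · exact Or.inl rfl
      · exact Or.inr (mem_nbrs.2 (Or.inr (Or.inl ⟨he, rfl⟩)))
    by_cases h3 : e = e₃
    · subst h3; rw [he₃, Sym2.mem_iff] at hw
      rcases hw with rfl | rfl
      · exact Or.inl rfl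
      · exact Or.inr (mem_nbrs.2 (Or.inr (Or.inr ⟨he, rfl⟩)))
    · rw [ha e h1 h2 h3] at he; exact Bool.noConfusion he
  constructor
  · intro hc
    -- `x` is not isolated: it lies on an open edge, hence is an open neighbour; same for `y`
    have hiso : ∀ w : V, w ≠ u → w ∉ nbrs v₁ v₂ v₃ (a e₁) (a e₂) (a e₃) →
        ∀ w', Conn ends a w w' → w' = w := by
      intro w hwu hwn w' hc'
      refine (mem_of_conn_of_closed (S := {w}) ?_ rfl hc')
      intro p hp q hpq
      rw [Set.mem_singleton_iff] at hp
      subst hp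
      rw [openGraph_adj] at hpq
      obtain ⟨_, e, he, hends⟩ := hpq
      have := hopen e he p (by rw [hends]; exact Sym2.mem_mk_left p q)
      rcases this with h | h
      · exact absurd h hwu
      · exact absurd h hwn
    by_cases hxn : x ∈ nbrs v₁ v₂ v₃ (a e₁) (a e₂) (a e₃)
    · by_cases hyn : y ∈ nbrs v₁ v₂ v₃ (a e₁) (a e₂) (a e₃)
      · exact ⟨hxn, hyn⟩
      · exact absurd (hiso y hy hyn x (conn_symm hc)) hxy
    · exact absurd (hiso x hx hxn y hc) (Ne.symm hxy)
  · rintro ⟨hxn, hyn⟩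
    -- both are joined to `u`
    have hju : ∀ w, w ∈ nbrs v₁ v₂ v₃ (a e₁) (a e₂) (a e₃) → Conn ends a u w := by
      intro w hw
      rcases mem_nbrs.1 hw with ⟨h, rfl⟩ | ⟨h, rfl⟩ | ⟨h, rfl⟩
      · exact conn_of_openAdj ⟨e₁, h, he₁⟩
      · exact conn_of_openAdj ⟨e₂, h, he₂⟩
      · exact conn_of_openAdj ⟨e₃, h, he₃⟩
    exact conn_trans (conn_symm (hju x hxn)) (hju y hyn)

/-- The terminal graph of a star placement is the clique graph of its open neighbours. -/
lemma fromRel_tRel_star {ends : E → Sym2 V} {u v₁ v₂ v₃ : V} {e₁ e₂ e₃ : E}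
    (he₁ : ends e₁ = s(u, v₁)) (he₂ : ends e₂ = s(u, v₂)) (he₃ : ends e₃ = s(u, v₃))
    (hv₁ : v₁ ≠ u) (hv₂ : v₂ ≠ u) (hv₃ : v₃ ≠ u) {a : Config E}
    (ha : ∀ e, e ≠ e₁ → e ≠ e₂ → e ≠ e₃ → a e = false) :
    SimpleGraph.fromRel (tRel ends {u} a) =
      SimpleGraph.fromRel (relOf (sMask v₁ v₂ v₃ (a e₁) (a e₂) (a e₃))) := by
  ext x y
  simp only [SimpleGraph.fromRel_adj, tRel, relOf, sMask, mem_cliq, Set.mem_singleton_iff]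
  constructor
  · rintro ⟨hxy, ⟨hx, hy, hc⟩ | ⟨hy, hx, hc⟩⟩
    · obtain ⟨h1, h2⟩ := (conn_star_iff he₁ he₂ he₃ hv₁ hv₂ hv₃ ha hx hy hxy).1 hc
      exact ⟨hxy, Or.inl ⟨h1, h2, hxy⟩⟩
    · obtain ⟨h1, h2⟩ := (conn_star_iff he₁ he₂ he₃ hv₁ hv₂ hv₃ ha hy hx (Ne.symm hxy)).1 hc
      exact ⟨hxy, Or.inr ⟨h1, h2, Ne.symm hxy⟩⟩
  · rintro ⟨hxy, ⟨hx, hy, _⟩ | ⟨hy, hx, _⟩⟩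
    · have hxu : x ≠ u := fun h => by
        rcases mem_nbrs.1 hx with ⟨_, rfl⟩ | ⟨_, rfl⟩ | ⟨_, rfl⟩ <;> exact absurd h ‹_ ≠ u›
      have hyu : y ≠ u := fun h => by
        rcases mem_nbrs.1 hy with ⟨_, rfl⟩ | ⟨_, rfl⟩ | ⟨_, rfl⟩ <;> exact absurd h ‹_ ≠ u›
      exact ⟨hxy, Or.inl ⟨hxu, hyu,
        (conn_star_iff he₁ he₂ he₃ hv₁ hv₂ hv₃ ha hxu hyu hxy).2 ⟨hx, hy⟩⟩⟩
    · have hxu : x ≠ u := fun h => by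
        rcases mem_nbrs.1 hx with ⟨_, rfl⟩ | ⟨_, rfl⟩ | ⟨_, rfl⟩ <;> exact absurd h ‹_ ≠ u›
      have hyu : y ≠ u := fun h => by
        rcases mem_nbrs.1 hy with ⟨_, rfl⟩ | ⟨_, rfl⟩ | ⟨_, rfl⟩ <;> exact absurd h ‹_ ≠ u›
      exact ⟨hxy, Or.inl ⟨hxu, hyu,
        (conn_star_iff he₁ he₂ he₃ hv₁ hv₂ hv₃ ha hxu hyu hxy).2 ⟨hx, hy⟩⟩⟩

end StarRel

/-! ## The star sum on an arbitrary base -/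

section StarSum

open Classical

variable {V : Type*} [Fintype V] [DecidableEq V] {E : Type*} [Fintype E] [DecidableEq E]
variable {R : Type*} [Field R]

/-- The star placement sum over a base: the 27 placements of the three star edges (each in the
copies its type prescribes), each copy carrying the clique mask of its open neighbours. -/
noncomputable def starSumM (F : Finset E) (z : Config E) (τ : E → ℕ) (ends : E → Sym2 V)
    (o a₁ a₂ a₃ b v₁ v₂ v₃ : V) (t₁ t₂ t₃ : ℕ) : R :=
  ∑ a : Bool, ∑ b₁ : Bool, ∑ c : Bool, if a.toNat + b₁.toNat + c.toNat = t₁ then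
    (∑ a' : Bool, ∑ b₂ : Bool, ∑ c' : Bool, if a'.toNat + b₂.toNat + c'.toNat = t₂ then
      (∑ a'' : Bool, ∑ b₃ : Bool, ∑ c'' : Bool, if a''.toNat + b₃.toNat + c''.toNat = t₃ then
        maskCount F z τ ends o a₁ a₂ a₃ b (sMask v₁ v₂ v₃ a a' a'') (sMask v₁ v₂ v₃ b₁ b₂ b₃)
          (sMask v₁ v₂ v₃ c c' c'')
      else 0) else 0) else 0

omit [Fintype V] in
/-- **The degree-three star over any base**: the typed base of the crux kernel at an unmarked
vertex `u` of typed degree three (neighbours `v₁, v₂, v₃`, arbitrary) is the star sum of the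
masked counts of the base `F ∖ {e₁, e₂, e₃}`. -/
theorem typedCount_star3_sum (ends : E → Sym2 V) (o a₁ a₂ a₃ b : V) {u v₁ v₂ v₃ : V}
    (hu : u ≠ o ∧ u ≠ a₁ ∧ u ≠ a₂ ∧ u ≠ a₃ ∧ u ≠ b) {e₁ e₂ e₃ : E} (he₁ : ends e₁ = s(u, v₁))
    (he₂ : ends e₂ = s(u, v₂)) (he₃ : ends e₃ = s(u, v₃)) (hv₁ : v₁ ≠ u) (hv₂ : v₂ ≠ u)
    (hv₃ : v₃ ≠ u) (h12 : e₁ ≠ e₂) (h13 : e₁ ≠ e₃) (h23 : e₂ ≠ e₃) {F : Finset E} (h1 : e₁ ∈ F)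
    (h2 : e₂ ∈ F) (h3 : e₃ ∈ F) (z : Config E) (τ : E → ℕ)
    (hdeg : ∀ e, u ∈ ends e → e = e₁ ∨ e = e₂ ∨ e = e₃ ∨ (e ∉ F ∧ z e = false)) :
    typedCount F z τ (K3 ends o a₁ a₂ a₃ b : Config E → Config E → Config E → R) =
      starSumM (((F.erase e₁).erase e₂).erase e₃)
        (Function.update (Function.update (Function.update z e₁ false) e₂ false) e₃ false) τ
        ends o a₁ a₂ a₃ b v₁ v₂ v₃ (τ e₁) (τ e₂) (τ e₃) := by
  rw [typedCount_split3 F h1 h2 h3 h12 h13 h23]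
  unfold starSumM
  set F' := ((F.erase e₁).erase e₂).erase e₃ with hF'
  set z' := Function.update (Function.update (Function.update z e₁ false) e₂ false) e₃ false
    with hz'
  set L : Finset E := {e₁, e₂, e₃} with hL
  have hL1 : e₁ ∈ L := by simp [hL]
  have hL2 : e₂ ∈ L := by simp [hL]
  have hL3 : e₃ ∈ L := by simp [hL]
  have hmemL : ∀ e, e ∈ L ↔ e = e₁ ∨ e = e₂ ∨ e = e₃ := fun e => by simp [hL]
  have hLF' : ∀ e ∈ L, e ∉ F' := fun e he => by
    rcases (hmemL e).1 he with rfl | rfl | rfl <;> simp [hF']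
  have hz'L : ∀ e ∈ L, z' e = false := fun e he => by
    rcases (hmemL e).1 he with rfl | rfl | rfl
    · rw [hz', Function.update_of_ne h13, Function.update_of_ne h12, Function.update_self]
    · rw [hz', Function.update_of_ne h23, Function.update_self]
    · rw [hz', Function.update_self]
  have hz'off : ∀ e, e ∉ L → z' e = z e := fun e he => by
    have h1' : e ≠ e₁ := fun h => he (h ▸ hL1)
    have h2' : e ≠ e₂ := fun h => he (h ▸ hL2)
    have h3' : e ≠ e₃ := fun h => he (h ▸ hL3)
    rw [hz', Function.update_of_ne h3', Function.update_of_ne h2', Function.update_of_ne h1']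
  -- the kernel at a star placement is the masked kernel
  have hker : ∀ (x : Config E), (∀ e, e ∉ F' → x e = z' e) → ∀ (a a' a'' : Bool),
      st ends o a₁ a₂ a₃ b (Function.update (Function.update (Function.update x e₃ a'') e₂ a') e₁ a) =
        stG o a₁ a₂ a₃ b (openGraph ends x ⊔
          SimpleGraph.fromRel (relOf (sMask v₁ v₂ v₃ a a' a''))) := by
    intro x hx a a' a''
    set ω := Function.update (Function.update (Function.update x e₃ a'') e₂ a') e₁ a with hω
    have hω1 : ω e₁ = a := by rw [hω, Function.update_self]
    have hω2 : ω e₂ = a' := by rw [hω, Function.update_of_ne h12.symm, Function.update_self]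
    have hω3 : ω e₃ = a'' := by
      rw [hω, Function.update_of_ne h13.symm, Function.update_of_ne h23.symm, Function.update_self]
    have hωoff : ∀ e, e ∉ L → ω e = x e := fun e he => by
      have h1' : e ≠ e₁ := fun h => he (h ▸ hL1)
      have h2' : e ≠ e₂ := fun h => he (h ▸ hL2)
      have h3' : e ≠ e₃ := fun h => he (h ▸ hL3)
      rw [hω, Function.update_of_ne h1', Function.update_of_ne h2', Function.update_of_ne h3']
    have hxL : ∀ e ∈ L, x e = false := fun e he => by rw [hx e (hLF' e he)]; exact hz'L e he
    have hcl : ∀ e, e ∉ L → (∃ w ∈ ({u} : Set V), w ∈ ends e) → ω e = false := by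
      intro e he hw
      obtain ⟨w, hw, hwe⟩ := hw
      rw [Set.mem_singleton_iff] at hw
      subst hw
      rcases hdeg e hwe with rfl | rfl | rfl | ⟨heF, hze⟩
      · exact absurd hL1 he
      · exact absurd hL2 he
      · exact absurd hL3 he
      · have heF' : e ∉ F' := fun h => heF (Finset.mem_of_mem_erase (Finset.mem_of_mem_erase
          (Finset.mem_of_mem_erase h)))
        rw [hωoff e he, hx e heF', hz'off e he, hze]
    have hI : ∀ w ∈ ({u} : Set V), w ≠ o ∧ w ≠ a₁ ∧ w ≠ a₂ ∧ w ≠ a₃ ∧ w ≠ b := fun w hw => by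
      rw [Set.mem_singleton_iff] at hw; subst hw; exact hu
    rw [st_mask ends o a₁ a₂ a₃ b hI L ω hcl, maskGraph]
    have hoff : offL L ω = x := by
      funext e
      by_cases he : e ∈ L
      · rw [offL_of_mem he, hxL e he]
      · rw [offL_of_not_mem he, hωoff e he]
    have hon : ∀ e, e ≠ e₁ → e ≠ e₂ → e ≠ e₃ → onL L ω e = false := fun e h1' h2' h3' =>
      onL_of_not_mem (fun h => by rcases (hmemL e).1 h with h | h | h <;> contradiction)
    rw [hoff, fromRel_tRel_star he₁ he₂ he₃ hv₁ hv₂ hv₃ hon, onL_of_mem hL1, onL_of_mem hL2,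
      onL_of_mem hL3, hω1, hω2, hω3]
  refine Finset.sum_congr rfl fun a _ => Finset.sum_congr rfl fun b₁ _ =>
    Finset.sum_congr rfl fun c _ => ?_
  refine if_congr Iff.rfl ?_ rfl
  refine Finset.sum_congr rfl fun a' _ => Finset.sum_congr rfl fun b₂ _ =>
    Finset.sum_congr rfl fun c' _ => ?_
  refine if_congr Iff.rfl ?_ rfl
  refine Finset.sum_congr rfl fun a'' _ => Finset.sum_congr rfl fun b₃ _ =>
    Finset.sum_congr rfl fun c'' _ => ?_
  refine if_congr Iff.rfl ?_ rfl
  unfold maskCount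
  refine typedCount_congr_K_on _ _ _ fun x y w hxyw _ => ?_
  rw [K3_eq_KB, hker x (fun e he => (hxyw e he).1) a a' a'',
    hker y (fun e he => (hxyw e he).2.1) b₁ b₂ b₃, hker w (fun e he => (hxyw e he).2.2) c c' c'']

end StarSum

end Mask

end TypedRed

end CovForm

end Summit.Ventures.PercRepro2
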